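import Summits.BirchSwinnertonDyer.BirchSwinnertonDyer.Theorems.SignedLowerHalvesSprungLowerHalfAtThreeTwistBootstrap
import Summits.BirchSwinnertonDyer.BirchSwinnertonDyer.Theorems.SignedLowerHalvesSprungLowerHalfAtThreeAnticyclotomicConverse
import HarnessLib

/-!
# Route `SignedLowerHalves`, crux `SprungLowerHalfAtThree` (item stmt-BirchSwinnertonDyer-19003): the ROUTE
# DECL BY NAME from the ANTICYCLOTOMIC data alone — (conv₀) by gen 7's road, (low₀) by the TWIST BOOTSTRAP
# (companion of `…TwistBootstrap.lean`; cell `bsd-ssimc`, seat `bsd-ssimc-k3-c5` gen 8, object «LOW0-TWIST»;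
# `--supports … --as helper`; theorems only; the ONE Theses-importing file of the object; closes nothing)

PARTITION (cell bsd-ssimc): X8 (A8) × p = 3 — types-the-object-of (crux 5 = Modularity ∧ (conv₀) ∧ (low₀),
p421771); closes NONE; 0 census moves; nothing booked; BSD is not proved by any of this.

WHAT THIS FILE RECORDS. After gen 7 (p461545: (conv₀) ⟸ the anticyclotomic road — JSW 2017 Thm. 3.3.1 BY
NAME + the displayed links (CLW22 ∘ BDP in non-vanishing currency, Gross–Zagier) at ONE auxiliary Heegner-type
datum per curve) and the companion file (p476757: (low₀) ⟸ JSW 3.3.1 + Kolyvagin 1990 + Gross–Zagier + GZK BY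
NAME + ONE displayed link (IMC≥∘BDP)ᵍ in valuation currency at a classical Heegner datum + a second Heegner
datum for the rank-one twist whose rank-zero twist lies in the 3-adic Tamagawa zone), the crux
`Theses.SignedLowerHalves.SprungLowerHalfAtThree` holds GRANTED: the PUBLISHED facts (modularity `hmodE`/`hmodP`,
the period unit at `3`, GZK, the entire continuation, JSW 3.3.1, Gross–Zagier / Kolyvagin qualitative,
Kolyvagin's index bound) and, for every X8 curve, the EXISTENCE of the auxiliary data carrying the displayed
links — `hroad` (gen 7's ∀∃ binder, verbatim) and `htwist` (this object's ∀∃ binder). NO `±`/`♯♭` object, NO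
Beilinson–Flach class, NO preprint binder enters. OPEN inputs (planner D24-3 (1)), all DISPLAYED: the
anticyclotomic Eisenstein divisibility at `(3, ±3)` (in two currencies; not in print at Heegner fields for a
non-ordinary prime; Castella–Liu–Wan 2022 Thm. 8.2.1 at `N⁻ ≠ 1`), the twist supplies (BFH 1990 / Friedberg–
Hoffstein 1995 in root-number form; the 3-adic Tamagawa-zone partner — Ono–Skinner-type, OPEN at the fixed
prime 3), and the numerical side conditions (`3 ∤ c`, `3 ∤ #𝓞^×`, `3 ∤ ∏c`, surjectivity of `ρ̄_{E^{(d₁)},3}`).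

Contents: `X8.bsdp_of_twistBootstrap_of_surj` (leaf branch r0 ∧ surj: + Wuthrich 2014 Prop. 21 BY NAME);
`X8.low0_of_twistBootstrapRoad` (the (low₀) binder of p421771 fed by the road); `sprungLowerHalfAtThree_of_acRoads`
(the ROUTE DECL BY NAME).

References: [JetchevSkinnerWan2017] Thm. 3.3.1, §7.4; [KolyvaginEulerSystems1990] Thm. A; [McCallumLMS1991] §1;
[Wuthrich2014] Prop. 21; [CastellaLiuWan2022] Thm. 8.2.1; [Sprung2017] Thm. 1.12, Cor. 4.11; [Miller2011LMS] Def. 1.1.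
-/

set_option autoImplicit false
set_option linter.dupNamespace false

noncomputable section

open scoped Classical NumberField

open WeierstrassCurve NumberField IsDedekindDomain Literature.NumberTheory.EllipticCurves
  Literature.NumberTheory.EllipticCurves.ModularForms
  Literature.NumberTheory.EllipticCurves.Rank1Residual
  Literature.NumberTheory.EllipticCurves.Rank1Residual.Typed
  Literature.NumberTheory.EllipticCurves.Castella2018
  Summit.BirchSwinnertonDyer.Rank1Residual

namespace Summit.BirchSwinnertonDyer.BirchSwinnertonDyer.Theorems.X8TwistBootstrap

/-- **`BSD(E,3)` on the LEAF BRANCH X8 ∧ r0 ∧ surj(3) by the twist bootstrap** — the lower half above +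
Wuthrich 2014 Prop. 21 (`hW`, PUBLISHED, the cell's rank-0 upper half of record on `Surj W 3`) via
`Typed.X8.bsdp_of_missingLowerBoundAt_of_surj`. Same data, same ONE displayed link; closes nothing (the
displayed link and the twist-pair data are not theorems about any curve).
[cite: Wuthrich2014, Prop. 21 (p. 400)] [cite: JetchevSkinnerWan2017, Thm. 3.3.1, §7.4.1–§7.4.2]
[cite: McCallumLMS1991, §1 Theorem (Kolyvagin), p. 296] [cite: Miller2011LMS, §1 and Def. 1.1] -/
theorem X8.bsdp_of_twistBootstrap_of_surj (hW : Wuthrich2014.sha_dvd_analyticSha)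
    (h331 : JetchevSkinnerWan2017.thm331_anticyclotomicControl_general)
    (hGZK : rank_eq_analyticRank_of_analyticRank_le_one) (hmod : hasEntireLFunction_rat)
    (hmodP : nonempty_modularParametrizationData)
    (W : WeierstrassCurve ℚ) [W.IsElliptic] [W.IsGloballyMinimal] (hX : ClassX8 W 3)
    (hs : Surj W 3) (hr : W.analyticRank = 0)
    (N : ℕ) [NeZero N] (hN : W.conductorNorm ℤ = N) (K : Type) [Field K] [NumberField K]
    (hGZ : gross_zagier N W K) (hKo : kolyvagin N W K)
    (hK : IsImaginaryQuadratic K) (hHN : SatisfiesHeegnerHypothesis N K)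
    (hHp : SatisfiesHeegnerHypothesis 3 K)
    (Dt : ModularParametrizationData W N) (H : HeegnerDatum N (NumberField.discr K)) (ιC : K →+* ℂ)
    (P : (W.baseChange K).toAffine.Point)
    (hP : WeierstrassCurve.Affine.Point.map ιC.toRatAlgHom P = heegnerPointComplex Dt H)
    (hc : ¬ ((3 : ℕ) : ℤ) ∣ Dt.c) (hμ : ¬ (3 : ℕ) ∣ Units.torsionOrder K)
    (Wd : WeierstrassCurve ℚ) [Wd.IsElliptic] [Wd.IsGloballyMinimal] (Cd : VariableChange ℚ)
    (hWd : Cd • W.quadraticTwist (NumberField.discr K : ℚ) = Wd)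
    (hu : padicValRat 3 (Cd.u : ℚ) = 0) (hrd : Wd.analyticRank = 1)
    (htam : padicValNat 3 Wd.tamagawaProduct = padicValNat 3 W.tamagawaProduct)
    (hsurjd : Wd.HasSurjectiveModNGaloisRep 3) (htam0 : ¬ (3 : ℕ) ∣ Wd.tamagawaProduct)
    (hLA : ∀ (κ : ZpExtension K 3), κ.IsAnticyclotomic →
      ∀ (γ : Field.absoluteGaloisGroup K) [Fact (κ.IsTopGenerator γ)] (𝔭 : HeightOneSpectrum (𝓞 K))
        (h𝔭 : (((3 : ℕ) : ℕ) : 𝓞 K) ∈ 𝔭.asIdeal) (he : 𝔭.asIdeal.ramificationIdx (𝓞 ℚ) = 1)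
        (hf : 𝔭.asIdeal.inertiaDeg (𝓞 ℚ) = 1),
        X11b.IMCLowerWaldspurgerOnTreeGoodAt 3 κ 𝔭 γ (X11b.embAt K 3 𝔭 h𝔭 he hf) P)
    (N₁ : ℕ) [NeZero N₁] (K₂ : Type) [Field K₂] [NumberField K₂]
    (hGZ₂ : gross_zagier N₁ Wd K₂) (hKo₂ : kolyvagin N₁ Wd K₂)
    (hB : Kolyvagin1990_padicValNat_card_sha_le N₁ Wd K₂)
    (hK₂ : IsImaginaryQuadratic K₂) (hHN₂ : SatisfiesHeegnerHypothesis N₁ K₂)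
    (Dt₂ : ModularParametrizationData Wd N₁) (H₂ : HeegnerDatum N₁ (NumberField.discr K₂))
    (ι₂ : K₂ →+* ℂ) (P₂ : (Wd.baseChange K₂).toAffine.Point)
    (hP₂ : WeierstrassCurve.Affine.Point.map ι₂.toRatAlgHom P₂ = heegnerPointComplex Dt₂ H₂)
    (hc₂ : ¬ ((3 : ℕ) : ℤ) ∣ Dt₂.c) (hμ₂ : ¬ (3 : ℕ) ∣ Units.torsionOrder K₂)
    (hLt₂ : (Wd.quadraticTwist (NumberField.discr K₂ : ℚ)).entireLFunction 1 ≠ 0)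
    (Wdd : WeierstrassCurve ℚ) [Wdd.IsElliptic] [Wdd.IsGloballyMinimal] (Cdd : VariableChange ℚ)
    (hWdd : Cdd • Wd.quadraticTwist (NumberField.discr K₂ : ℚ) = Wdd)
    (hu₂ : padicValRat 3 (Cdd.u : ℚ) = 0)
    (htam₂ : padicValNat 3 Wdd.tamagawaProduct = padicValNat 3 Wd.tamagawaProduct)
    (hzone : ∃ q : ℚ, Wdd.entireLFunction 1 / (Wdd.realPeriodRat : ℂ) = (q : ℂ) ∧
      padicValRat 3 q + 2 * padicValNat 3 Wdd.torsionOrder ≤ padicValNat 3 Wdd.tamagawaProduct) :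
    BSDp W 3 :=
  Typed.X8.bsdp_of_missingLowerBoundAt_of_surj W 3 hW hGZK hmod hX hs hr
    (X8.missingLowerBoundAt_of_twistBootstrap h331 hGZK hmod hmodP W hX hr N hN K hGZ hKo hK hHN hHp Dt
      H ιC P hP hc hμ Wd Cd hWd hu hrd htam hsurjd htam0 hLA N₁ K₂ hGZ₂ hKo₂ hB hK₂ hHN₂ Dt₂ H₂ ι₂ P₂
      hP₂ hc₂ hμ₂ hLt₂ Wdd Cdd hWdd hu₂ htam₂ hzone)

/-! ### The (low₀) binder of p421771 from the twist-bootstrap road (∀∃ over X8 ∧ r0) -/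

/-- **The twist-bootstrap road supplies the (low₀) binder of the crux's characterisation.** Granted the
PUBLISHED facts BY NAME — JSW 3.3.1 (`h331`), Gross–Zagier (`hGZ`) and Kolyvagin (`hKo`, `hB`) at every
`(N, W, K)`, GZK, modularity (`hmod`, `hmodP`) — and, for EVERY rank-zero X8 curve, the EXISTENCE of a twist
pair `(K₁, K₂)` with its Heegner data carrying the ONE displayed link `hLA` and the numerical side conditions
(the ∀∃ binder `htwist`: in print the fields come from BFH 1990 / Waldspurger in root-number form, the link
from the anticyclotomic Eisenstein divisibility — OPEN at `(3, ±3)` — and the zone condition is a horizontal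
3-indivisibility statement, OPEN class-wide), (low₀) holds on ALL of X8 in exactly the binder shape `hlow` of
`Theorems.sprungLowerHalfAtThree_of_corankZero_inputs` (p421771). Pure logic over the companion's
`X8.missingLowerBoundAt_of_twistBootstrap`. CONDITIONAL; closes nothing.
[cite: JetchevSkinnerWan2017, Thm. 3.3.1, §7.4.1–§7.4.2 (arXiv:1512.06894 pp. 11, 30–31)]
[cite: McCallumLMS1991, §1 Theorem (Kolyvagin), p. 296] [cite: Miller2011LMS, Def. 1.1] -/
theorem X8.low0_of_twistBootstrapRoad
    (h331 : JetchevSkinnerWan2017.thm331_anticyclotomicControl_general)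
    (hGZ : ∀ (N : ℕ) [NeZero N] (V : WeierstrassCurve ℚ) (K : Type) [Field K] [NumberField K],
      gross_zagier N V K)
    (hKo : ∀ (N : ℕ) [NeZero N] (V : WeierstrassCurve ℚ) (K : Type) [Field K] [NumberField K],
      kolyvagin N V K)
    (hB : ∀ (N : ℕ) [NeZero N] (V : WeierstrassCurve ℚ) (K : Type) [Field K] [NumberField K],
      Kolyvagin1990_padicValNat_card_sha_le N V K)
    (hGZK : rank_eq_analyticRank_of_analyticRank_le_one) (hmod : hasEntireLFunction_rat)
    (hmodP : nonempty_modularParametrizationData)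
    (htwist : ∀ (W : WeierstrassCurve ℚ) [W.IsElliptic] [W.IsGloballyMinimal],
      ClassX8 W 3 → W.analyticRank = 0 →
      ∃ (N : ℕ) (_ : NeZero N) (_ : W.conductorNorm ℤ = N) (K : Type) (_ : Field K) (_ : NumberField K)
        (_ : IsImaginaryQuadratic K) (_ : SatisfiesHeegnerHypothesis N K)
        (_ : SatisfiesHeegnerHypothesis 3 K)
        (Dt : ModularParametrizationData W N) (H : HeegnerDatum N (NumberField.discr K)) (ιC : K →+* ℂ)
        (P : (W.baseChange K).toAffine.Point)
        (_ : WeierstrassCurve.Affine.Point.map ιC.toRatAlgHom P = heegnerPointComplex Dt H)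
        (_ : ¬ ((3 : ℕ) : ℤ) ∣ Dt.c) (_ : ¬ (3 : ℕ) ∣ Units.torsionOrder K)
        (Wd : WeierstrassCurve ℚ) (_ : Wd.IsElliptic) (_ : Wd.IsGloballyMinimal) (Cd : VariableChange ℚ)
        (_ : Cd • W.quadraticTwist (NumberField.discr K : ℚ) = Wd)
        (_ : padicValRat 3 (Cd.u : ℚ) = 0) (_ : Wd.analyticRank = 1)
        (_ : padicValNat 3 Wd.tamagawaProduct = padicValNat 3 W.tamagawaProduct)
        (_ : Wd.HasSurjectiveModNGaloisRep 3) (_ : ¬ (3 : ℕ) ∣ Wd.tamagawaProduct)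
        (_ : ∀ (κ : ZpExtension K 3), κ.IsAnticyclotomic →
          ∀ (γ : Field.absoluteGaloisGroup K) [Fact (κ.IsTopGenerator γ)] (𝔭 : HeightOneSpectrum (𝓞 K))
            (h𝔭 : (((3 : ℕ) : ℕ) : 𝓞 K) ∈ 𝔭.asIdeal) (he : 𝔭.asIdeal.ramificationIdx (𝓞 ℚ) = 1)
            (hf : 𝔭.asIdeal.inertiaDeg (𝓞 ℚ) = 1),
            X11b.IMCLowerWaldspurgerOnTreeGoodAt 3 κ 𝔭 γ (X11b.embAt K 3 𝔭 h𝔭 he hf) P)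
        (N₁ : ℕ) (_ : NeZero N₁) (K₂ : Type) (_ : Field K₂) (_ : NumberField K₂)
        (_ : IsImaginaryQuadratic K₂) (_ : SatisfiesHeegnerHypothesis N₁ K₂)
        (Dt₂ : ModularParametrizationData Wd N₁) (H₂ : HeegnerDatum N₁ (NumberField.discr K₂))
        (ι₂ : K₂ →+* ℂ) (P₂ : (Wd.baseChange K₂).toAffine.Point)
        (_ : WeierstrassCurve.Affine.Point.map ι₂.toRatAlgHom P₂ = heegnerPointComplex Dt₂ H₂)
        (_ : ¬ ((3 : ℕ) : ℤ) ∣ Dt₂.c) (_ : ¬ (3 : ℕ) ∣ Units.torsionOrder K₂)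
        (_ : (Wd.quadraticTwist (NumberField.discr K₂ : ℚ)).entireLFunction 1 ≠ 0)
        (Wdd : WeierstrassCurve ℚ) (_ : Wdd.IsElliptic) (_ : Wdd.IsGloballyMinimal)
        (Cdd : VariableChange ℚ) (_ : Cdd • Wd.quadraticTwist (NumberField.discr K₂ : ℚ) = Wdd)
        (_ : padicValRat 3 (Cdd.u : ℚ) = 0)
        (_ : padicValNat 3 Wdd.tamagawaProduct = padicValNat 3 Wd.tamagawaProduct),
        ∃ q : ℚ, Wdd.entireLFunction 1 / (Wdd.realPeriodRat : ℂ) = (q : ℂ) ∧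
          padicValRat 3 q + 2 * padicValNat 3 Wdd.torsionOrder ≤ padicValNat 3 Wdd.tamagawaProduct) :
    ∀ (W : WeierstrassCurve ℚ) [W.IsElliptic] [W.IsGloballyMinimal],
      ClassX8 W 3 → W.analyticRank = 0 → MissingLowerBoundAt W 3 := by
  intro W _ _ hX hr
  obtain ⟨N, hNz, hN, K, _, _, hK, hHN, hHp, Dt, H, ιC, P, hP, hc, hμ, Wd, _, _, Cd, hWd, hu, hrd, htam,
    hsurjd, htam0, hLA, N₁, hN₁, K₂, _, _, hK₂, hHN₂, Dt₂, H₂, ι₂, P₂, hP₂, hc₂, hμ₂, hLt₂, Wdd, _, _, Cdd,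
    hWdd, hu₂, htam₂, hzone⟩ := htwist W hX hr
  haveI := hNz; haveI := hN₁
  exact X8.missingLowerBoundAt_of_twistBootstrap h331 hGZK hmod hmodP W hX hr N hN K (hGZ N W K) (hKo N W K)
    hK hHN hHp Dt H ιC P hP hc hμ Wd Cd hWd hu hrd htam hsurjd htam0 hLA N₁ K₂ (hGZ N₁ Wd K₂) (hKo N₁ Wd K₂)
    (hB N₁ Wd K₂) hK₂ hHN₂ Dt₂ H₂ ι₂ P₂ hP₂ hc₂ hμ₂ hLt₂ Wdd Cdd hWdd hu₂ htam₂ hzone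

/-! ### The ROUTE DECL BY NAME from the two anticyclotomic roads -/

/-- **The crux `Theses.SignedLowerHalves.SprungLowerHalfAtThree` BY NAME from the ANTICYCLOTOMIC roads alone.**
Granted the PUBLISHED facts (modularity `hmodE`, `hmodP`; the period unit at `3` `hper`; GZK; the entire
continuation; JSW 2017 Thm. 3.3.1 `h331`; Gross–Zagier, Kolyvagin, Kolyvagin's index bound at every
`(N, W, K)`), gen 7's (conv₀) road `hroad` (∀∃ over X8: an anticyclotomic datum carrying the links `hdiv`,
`hGZ` — `X8AnticyclotomicConverse.X8.conv0_of_acRoad`) and this object's (low₀) road `htwist` (∀∃ over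
X8 ∧ r0: a twist pair carrying `hLA` and the zone/side conditions — `X8.low0_of_twistBootstrapRoad`), the crux
holds: `Theorems.sprungLowerHalfAtThree_of_corankZero_inputs` (p421771) with BOTH binders fed by anticyclotomic
roads. So crux 5 ⟺ Modularity ∧ {ONE anticyclotomic Eisenstein link at (3, ±3), two currencies} ∧ {twist
supplies} ∧ published facts — NO `±`/`♯♭` object, NO Beilinson–Flach class, NO preprint. CONDITIONAL on the
displayed links and data (OPEN, planner D24-3 (1)); the item stays OPEN and is NOT claimed; closes nothing;
BSD is not proved by any of this. [cite: JetchevSkinnerWan2017, Thm. 3.3.1 with §3.5 (3.5.d), §7.4.1–§7.4.2]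
[cite: CastellaLiuWan2022, Thm. 8.2.1 (1)] [cite: McCallumLMS1991, §1 Theorem (Kolyvagin)]
[cite: Sprung2017, Thm. 1.12 and Cor. 4.11] [cite: DiamondShurman2005, Thm. 8.8.3] -/
theorem sprungLowerHalfAtThree_of_acRoads (hmodE : ModularForms.exists_isNewformOf)
    (hper : realPeriodRat_eq_unit_mul_plusPeriod_three)
    (hGZK : rank_eq_analyticRank_of_analyticRank_le_one) (hmod : hasEntireLFunction_rat)
    (hmodP : nonempty_modularParametrizationData)
    (h331 : JetchevSkinnerWan2017.thm331_anticyclotomicControl_general)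
    (hGZ : ∀ (N : ℕ) [NeZero N] (V : WeierstrassCurve ℚ) (K : Type) [Field K] [NumberField K],
      gross_zagier N V K)
    (hKo : ∀ (N : ℕ) [NeZero N] (V : WeierstrassCurve ℚ) (K : Type) [Field K] [NumberField K],
      kolyvagin N V K)
    (hB : ∀ (N : ℕ) [NeZero N] (V : WeierstrassCurve ℚ) (K : Type) [Field K] [NumberField K],
      Kolyvagin1990_padicValNat_card_sha_le N V K)
    -- gen 7's (conv₀) road (∀∃ over X8), verbatim
    (hroad : ∀ (W : WeierstrassCurve ℚ) [W.IsElliptic] [W.IsGloballyMinimal],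
      ClassX8 W 3 → Finite (W.selmerGroupPInfty 3) →
      ∃ (K : Type) (_ : Field K) (_ : NumberField K) (_ : IsImaginaryQuadratic K)
        (_ : SatisfiesHeegnerHypothesis 3 K)
        (_ : (W.quadraticTwist (NumberField.discr K : ℚ)).analyticRank = 1)
        (_ : (W.baseChange K).HasIrreducibleModPGaloisRep 3)
        (ι : K →+* ℚ_[3]) (v : HeightOneSpectrum (𝓞 K))
        (_ : ∀ x : 𝓞 K, x ∈ v.asIdeal ↔ ‖ι (x : K)‖ < 1)
        (κ : ZpExtension K 3) (_ : κ.IsAnticyclotomic) (γ : Field.absoluteGaloisGroup K)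
        (_ : Fact (κ.IsTopGenerator γ)) (PK : (W.baseChange K).toAffine.Point),
        (∀ F : IwasawaAlgebra 3,
          AcSelmer.XAc.charIdeal (W.baseChange K) 3 κ v ∅ γ = Ideal.span {F} →
            ∃ c : ℚ_[3], ((PowerSeries.constantCoeff F : ℤ_[3]) : ℚ_[3]) =
              c * ((W.baseChange ℚ_[3]).padicLogPoint (formalIndex W 3 • padicPointOf W 3 ι PK) /
                (formalIndex W 3 : ℚ_[3])) ^ 2) ∧
        (¬ IsOfFinAddOrder PK → LDerivEK W K ≠ 0))
    -- this object's (low₀) road (∀∃ over X8 ∧ r0)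
    (htwist : ∀ (W : WeierstrassCurve ℚ) [W.IsElliptic] [W.IsGloballyMinimal],
      ClassX8 W 3 → W.analyticRank = 0 →
      ∃ (N : ℕ) (_ : NeZero N) (_ : W.conductorNorm ℤ = N) (K : Type) (_ : Field K) (_ : NumberField K)
        (_ : IsImaginaryQuadratic K) (_ : SatisfiesHeegnerHypothesis N K)
        (_ : SatisfiesHeegnerHypothesis 3 K)
        (Dt : ModularParametrizationData W N) (H : HeegnerDatum N (NumberField.discr K)) (ιC : K →+* ℂ)
        (P : (W.baseChange K).toAffine.Point)
        (_ : WeierstrassCurve.Affine.Point.map ιC.toRatAlgHom P = heegnerPointComplex Dt H)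
        (_ : ¬ ((3 : ℕ) : ℤ) ∣ Dt.c) (_ : ¬ (3 : ℕ) ∣ Units.torsionOrder K)
        (Wd : WeierstrassCurve ℚ) (_ : Wd.IsElliptic) (_ : Wd.IsGloballyMinimal) (Cd : VariableChange ℚ)
        (_ : Cd • W.quadraticTwist (NumberField.discr K : ℚ) = Wd)
        (_ : padicValRat 3 (Cd.u : ℚ) = 0) (_ : Wd.analyticRank = 1)
        (_ : padicValNat 3 Wd.tamagawaProduct = padicValNat 3 W.tamagawaProduct)
        (_ : Wd.HasSurjectiveModNGaloisRep 3) (_ : ¬ (3 : ℕ) ∣ Wd.tamagawaProduct)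
        (_ : ∀ (κ : ZpExtension K 3), κ.IsAnticyclotomic →
          ∀ (γ : Field.absoluteGaloisGroup K) [Fact (κ.IsTopGenerator γ)] (𝔭 : HeightOneSpectrum (𝓞 K))
            (h𝔭 : (((3 : ℕ) : ℕ) : 𝓞 K) ∈ 𝔭.asIdeal) (he : 𝔭.asIdeal.ramificationIdx (𝓞 ℚ) = 1)
            (hf : 𝔭.asIdeal.inertiaDeg (𝓞 ℚ) = 1),
            X11b.IMCLowerWaldspurgerOnTreeGoodAt 3 κ 𝔭 γ (X11b.embAt K 3 𝔭 h𝔭 he hf) P)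
        (N₁ : ℕ) (_ : NeZero N₁) (K₂ : Type) (_ : Field K₂) (_ : NumberField K₂)
        (_ : IsImaginaryQuadratic K₂) (_ : SatisfiesHeegnerHypothesis N₁ K₂)
        (Dt₂ : ModularParametrizationData Wd N₁) (H₂ : HeegnerDatum N₁ (NumberField.discr K₂))
        (ι₂ : K₂ →+* ℂ) (P₂ : (Wd.baseChange K₂).toAffine.Point)
        (_ : WeierstrassCurve.Affine.Point.map ι₂.toRatAlgHom P₂ = heegnerPointComplex Dt₂ H₂)
        (_ : ¬ ((3 : ℕ) : ℤ) ∣ Dt₂.c) (_ : ¬ (3 : ℕ) ∣ Units.torsionOrder K₂)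
        (_ : (Wd.quadraticTwist (NumberField.discr K₂ : ℚ)).entireLFunction 1 ≠ 0)
        (Wdd : WeierstrassCurve ℚ) (_ : Wdd.IsElliptic) (_ : Wdd.IsGloballyMinimal)
        (Cdd : VariableChange ℚ) (_ : Cdd • Wd.quadraticTwist (NumberField.discr K₂ : ℚ) = Wdd)
        (_ : padicValRat 3 (Cdd.u : ℚ) = 0)
        (_ : padicValNat 3 Wdd.tamagawaProduct = padicValNat 3 Wd.tamagawaProduct),
        ∃ q : ℚ, Wdd.entireLFunction 1 / (Wdd.realPeriodRat : ℂ) = (q : ℂ) ∧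
          padicValRat 3 q + 2 * padicValNat 3 Wdd.torsionOrder ≤ padicValNat 3 Wdd.tamagawaProduct) :
    Summit.BirchSwinnertonDyer.BirchSwinnertonDyer.Theses.SignedLowerHalves.SprungLowerHalfAtThree :=
  Summit.BirchSwinnertonDyer.BirchSwinnertonDyer.Theorems.sprungLowerHalfAtThree_of_corankZero_inputs
    hmodE hper hGZK hmod (X8AnticyclotomicConverse.X8.conv0_of_acRoad h331 hGZK hmod hroad)
    (X8.low0_of_twistBootstrapRoad h331 hGZ hKo hB hGZK hmod hmodP htwist)

end Summit.BirchSwinnertonDyer.BirchSwinnertonDyer.Theorems.X8TwistBootstrap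

end
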